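import Literature.NumberTheory.Transcendental.NesterenkoElimination
import Mathlib.RingTheory.Int.Basic
import Mathlib.Data.ZMod.Basic
import Mathlib.Algebra.MvPolynomial.Funext
import HarnessLib

/-!
# Heights of polynomials over `ℚ` through primitive integer representatives; Gauss's lemma (towards LNM 1752 Ch. 3 Prop. 4.7 2))

Topic `Literature/NumberTheory/Transcendental`. For Nesterenko's height `h(P)` of a polynomial
`P ∈ ℚ[T]` (Definition 4.2 of LNM 1752 Ch. 3 for `K = ℚ`: the logarithmic height of the vector of
coefficients, `Nesterenko.height`), the classical description through the product formula:
`P = c · P°` with `P°` a PRIMITIVE integer polynomial (coprime coefficients), and then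
`h(P) = log max |coefficients of P°|`. Together with **Gauss's lemma** (a product of primitive
integer polynomials is primitive — Bombieri–Gubler Lemma 1.6.3 at the finite places) this reduces
the height of a product to the maximum modulus of the coefficients of integer polynomials, where
Gelfond's lemma applies. Proofs only (no definitions, no named facts):

* `exists_eq_C_mul_map_primitive` — `P = C c * map ℤ→ℚ Z`, `c ≠ 0`, `Z` primitive with the same
  support;
* `gcd_coeff_mul_eq_one`, `gcd_coeff_prod_eq_one` — Gauss's lemma for `MvPolynomial σ ℤ`;
* `log_abs_coeff_le_height_map`, `height_map_eq_log_abs_coeff` — for primitive `Z ≠ 0`,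
  `h(Z) ≥ log |a|` for every coefficient `a`, with equality for a coefficient of maximal modulus
  (Mathlib's `Rat.logHeight_eq_max_abs_of_gcd_eq_one`).

## References

* [NesterenkoPhilippon2001] LNM 1752 (2001), Ch. 3 §4, Def. 4.2 and the remark after it (p. 38).
* [BombieriGubler2006] E. Bombieri, W. Gubler, *Heights in Diophantine Geometry*, §1.6, Lemma 1.6.3
  (Gauss's lemma), 1.5.14.
-/

noncomputable section

open MvPolynomial Height

namespace Literature.NumberTheory.Transcendental

namespace Nesterenko

variable {σ : Type*}

/-! ### Primitive integer representatives -/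

/-- **Primitive representative.** Every non-zero `P ∈ ℚ[T]` is `c · Z` with `c ∈ ℚˣ` and `Z` an
integer polynomial with coprime coefficients and the same support (clear denominators, divide by
the gcd). [cite: NesterenkoPhilippon2001, Ch. 3 §4, remark after Def. 4.2 (p. 38)] -/
theorem exists_eq_C_mul_map_primitive (P : MvPolynomial σ ℚ) (hP : P ≠ 0) :
    ∃ c : ℚ, c ≠ 0 ∧ ∃ Z : MvPolynomial σ ℤ,
      P = C c * map (Int.castRingHom ℚ) Z ∧ Z.support = P.support ∧
        Z.support.gcd (fun γ => coeff γ Z) = 1 := by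
  classical
  have hne : P.support.Nonempty := by
    rw [Finset.nonempty_iff_ne_empty, Ne, support_eq_empty]
    exact hP
  -- clear denominators: `N = ∏ den`, `y γ = coeff γ · N ∈ ℤ`
  set N : ℕ := ∏ γ ∈ P.support, (coeff γ P).den with hN
  have hN0 : (N : ℚ) ≠ 0 := by
    rw [hN]
    exact_mod_cast Finset.prod_ne_zero_iff.mpr fun γ _ => (coeff γ P).den_nz
  have hdvd : ∀ γ, (coeff γ P).den ∣ N := by
    intro γ
    by_cases hγ : γ ∈ P.support
    · exact Finset.dvd_prod_of_mem _ hγ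
    · rw [notMem_support_iff.mp hγ, Rat.den_zero]
      exact one_dvd _
  set y : (σ →₀ ℕ) → ℤ := fun γ => (coeff γ P).num * ((N / (coeff γ P).den : ℕ) : ℤ) with hy
  have hyq : ∀ γ, (y γ : ℚ) = coeff γ P * N := by
    intro γ
    have hN' : (N : ℚ) = (coeff γ P).den * ((N / (coeff γ P).den : ℕ) : ℚ) := by
      exact_mod_cast (Nat.mul_div_cancel' (hdvd γ)).symm
    rw [hy]
    simp only [Int.cast_mul, Int.cast_natCast]
    rw [hN', ← mul_assoc, Rat.mul_den_eq_num]
  -- divide by the gcd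
  obtain ⟨z, hz, hgcd⟩ := Finset.extract_gcd y hne
  set g : ℤ := P.support.gcd y with hg
  have hy0 : ∀ γ ∈ P.support, y γ ≠ 0 := by
    intro γ hγ h0
    have h := hyq γ
    rw [h0, Int.cast_zero] at h
    exact (mul_ne_zero (mem_support_iff.mp hγ) hN0) h.symm
  have hg0 : g ≠ 0 := by
    intro h0
    rw [hg, Finset.gcd_eq_zero_iff] at h0
    obtain ⟨γ, hγ⟩ := hne
    exact hy0 γ hγ (h0 γ hγ)
  have hz0 : ∀ γ ∈ P.support, z γ ≠ 0 := by
    intro γ hγ h0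
    apply hy0 γ hγ
    rw [hz γ hγ, h0, mul_zero]
  -- the integer polynomial `Z = ∑ z γ · T^γ`
  set Z : MvPolynomial σ ℤ := ∑ γ ∈ P.support, monomial γ (z γ) with hZ
  have hcoeffZ : ∀ γ, coeff γ Z = if γ ∈ P.support then z γ else 0 := by
    intro γ
    rw [hZ, coeff_sum]
    simp_rw [coeff_monomial]
    split_ifs with hγ
    · rw [Finset.sum_eq_single γ (fun δ _ hδ => if_neg hδ) (fun h => absurd hγ h), if_pos rfl]
    · exact Finset.sum_eq_zero fun δ hδ => if_neg fun h => hγ (by subst h; exact hδ)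
  have hsuppZ : Z.support = P.support := by
    ext γ
    rw [mem_support_iff, hcoeffZ]
    split_ifs with hγ
    · exact ⟨fun _ => hγ, fun _ => hz0 γ hγ⟩
    · simp [hγ]
  refine ⟨(g : ℚ) / N, div_ne_zero (by exact_mod_cast hg0) hN0, Z, ?_, hsuppZ, ?_⟩
  · ext γ
    rw [coeff_C_mul, coeff_map, hcoeffZ]
    split_ifs with hγ
    · have h := hyq γ
      rw [hz γ hγ, Int.cast_mul] at h
      simp only [eq_intCast]
      rw [div_mul_eq_mul_div, h, mul_div_assoc, div_self hN0, mul_one]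
    · rw [notMem_support_iff.mp hγ]
      simp
  · rw [hsuppZ, ← hgcd]
    exact Finset.gcd_congr rfl fun γ hγ => by rw [hcoeffZ, if_pos hγ]

/-! ### Gauss's lemma over `ℤ` -/

/-- The gcd of the coefficients being `1` forces the polynomial to be non-zero. [folklore] -/
theorem ne_zero_of_gcd_coeff_eq_one {Z : MvPolynomial σ ℤ}
    (hZ : Z.support.gcd (fun γ => coeff γ Z) = 1) : Z ≠ 0 := by
  intro h
  rw [h, support_zero, Finset.gcd_empty] at hZ
  exact zero_ne_one hZ

/-- A prime dividing all coefficients of an integer polynomial divides the gcd of its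
coefficients (so there is none if the polynomial is primitive). [folklore] -/
theorem not_dvd_of_gcd_coeff_eq_one {Z : MvPolynomial σ ℤ}
    (hZ : Z.support.gcd (fun γ => coeff γ Z) = 1) {p : ℤ} (hp : Prime p) :
    ∃ γ, ¬p ∣ coeff γ Z := by
  by_contra h
  simp only [not_exists, not_not] at h
  have hdvd : p ∣ Z.support.gcd (fun γ => coeff γ Z) := Finset.dvd_gcd fun γ _ => h γ
  rw [hZ] at hdvd
  exact hp.not_unit (isUnit_of_dvd_one hdvd)

/-- Reduction modulo a prime `p` kills an integer polynomial iff `p` divides all its coefficients.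
[folklore] -/
theorem map_zmod_eq_zero_iff (Z : MvPolynomial σ ℤ) (q : ℕ) :
    map (Int.castRingHom (ZMod q)) Z = 0 ↔ ∀ γ, (q : ℤ) ∣ coeff γ Z := by
  constructor
  · intro h γ
    have hc := congrArg (coeff γ) h
    rw [coeff_map, coeff_zero, eq_intCast, ZMod.intCast_zmod_eq_zero_iff_dvd] at hc
    exact hc
  · intro h
    ext γ
    rw [coeff_map, coeff_zero, eq_intCast, ZMod.intCast_zmod_eq_zero_iff_dvd]
    exact h γ

/-- **Gauss's lemma** for integer polynomials in several variables: the product of two primitive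
polynomials is primitive (reduce modulo a prime dividing all coefficients of the product: over the
field `ℤ/p` a product of non-zero polynomials is non-zero).
[cite: BombieriGubler2006, §1.6, Lemma 1.6.3] -/
theorem gcd_coeff_mul_eq_one {Z W : MvPolynomial σ ℤ}
    (hZ : Z.support.gcd (fun γ => coeff γ Z) = 1) (hW : W.support.gcd (fun γ => coeff γ W) = 1) :
    (Z * W).support.gcd (fun γ => coeff γ (Z * W)) = 1 := by
  by_contra hne
  -- a prime `p` dividing the (non-unit) gcd of the coefficients of `Z W`
  set g := (Z * W).support.gcd (fun γ => coeff γ (Z * W)) with hg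
  have hg_nonneg : 0 ≤ g := by
    rw [hg, ← Finset.normalize_gcd, ← Int.abs_eq_normalize]
    exact abs_nonneg _
  have hg1 : g.natAbs ≠ 1 := by
    intro h1
    apply hne
    have h := Int.natAbs_eq_iff.mp h1
    omega
  obtain ⟨p, hp, hpg⟩ := Int.exists_prime_and_dvd hg1
  have hpall : ∀ γ, p ∣ coeff γ (Z * W) := by
    intro γ
    by_cases hγ : γ ∈ (Z * W).support
    · exact hpg.trans (Finset.gcd_dvd hγ)
    · rw [notMem_support_iff.mp hγ]
      exact dvd_zero p
  -- reduce modulo `q = |p|`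
  set q : ℕ := p.natAbs with hq
  have hqp : Nat.Prime q := Int.prime_iff_natAbs_prime.mp hp
  haveI : Fact (Nat.Prime q) := ⟨hqp⟩
  have hq_dvd : ∀ {a : ℤ}, p ∣ a ↔ (q : ℤ) ∣ a := fun {a} => by
    rw [hq, Int.natAbs_dvd]
  have hZW : map (Int.castRingHom (ZMod q)) (Z * W) = 0 :=
    (map_zmod_eq_zero_iff _ q).mpr fun γ => hq_dvd.mp (hpall γ)
  rw [map_mul, mul_eq_zero] at hZW
  rcases hZW with h | h
  · obtain ⟨γ, hγ⟩ := not_dvd_of_gcd_coeff_eq_one hZ hp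
    exact hγ (hq_dvd.mpr ((map_zmod_eq_zero_iff Z q).mp h γ))
  · obtain ⟨γ, hγ⟩ := not_dvd_of_gcd_coeff_eq_one hW hp
    exact hγ (hq_dvd.mpr ((map_zmod_eq_zero_iff W q).mp h γ))

/-- Gauss's lemma for finite products. [cite: BombieriGubler2006, §1.6, Lemma 1.6.3] -/
theorem gcd_coeff_prod_eq_one {ι : Type*} (s : Finset ι) (Z : ι → MvPolynomial σ ℤ)
    (hZ : ∀ j ∈ s, (Z j).support.gcd (fun γ => coeff γ (Z j)) = 1) :
    (∏ j ∈ s, Z j).support.gcd (fun γ => coeff γ (∏ j ∈ s, Z j)) = 1 := by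
  classical
  induction s using Finset.induction_on with
  | empty =>
    simp only [Finset.prod_empty]
    have h1 : (1 : MvPolynomial σ ℤ).support = {0} := by
      rw [← C_1, support_C]
      exact if_neg one_ne_zero
    rw [h1, Finset.gcd_singleton, ← C_1, coeff_C, if_pos rfl]
    rfl
  | insert a s ha ih =>
    rw [Finset.prod_insert ha]
    exact gcd_coeff_mul_eq_one (hZ a (Finset.mem_insert_self a s))
      (ih fun j hj => hZ j (Finset.mem_insert_of_mem hj))

/-- Gauss's lemma for powers. [cite: BombieriGubler2006, §1.6, Lemma 1.6.3] -/
theorem gcd_coeff_pow_eq_one {Z : MvPolynomial σ ℤ}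
    (hZ : Z.support.gcd (fun γ => coeff γ Z) = 1) (k : ℕ) :
    (Z ^ k).support.gcd (fun γ => coeff γ (Z ^ k)) = 1 := by
  rw [Finset.pow_eq_prod_const]
  exact gcd_coeff_prod_eq_one _ _ fun _ _ => hZ

/-! ### The height of a primitive integer polynomial -/

/-- The gcd over the subtype of a `Finset` is the gcd over the `Finset`. [folklore] -/
theorem gcd_univ_subtype_eq {β : Type*} [DecidableEq β] (s : Finset β) (f : β → ℤ) :
    (Finset.univ : Finset s).gcd (fun i => f i.1) = s.gcd f := by
  have himg : (Finset.univ : Finset s).image Subtype.val = s := by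
    rw [Finset.univ_eq_attach, Finset.attach_image_val]
  conv_rhs => rw [← himg]
  rw [Finset.gcd_image]
  rfl

/-- **`h(Z) = log max |coefficients|`** for a primitive integer polynomial (as an `⨆` over the
support), from the product formula: all non-archimedean factors are `1`
(Mathlib's `Rat.logHeight_eq_max_abs_of_gcd_eq_one`).
[cite: NesterenkoPhilippon2001, Ch. 3 §4, remark after Def. 4.2 (p. 38)] -/
theorem height_map_eq_log_ciSup (Z : MvPolynomial σ ℤ)
    (hZ : Z.support.gcd (fun γ => coeff γ Z) = 1) :
    height (map (Int.castRingHom ℚ) Z) =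
      Real.log ((⨆ i : Z.support, |coeff i.1 Z| : ℤ) : ℝ) := by
  classical
  have hZ0 : Z ≠ 0 := ne_zero_of_gcd_coeff_eq_one hZ
  have hsupp : (map (Int.castRingHom ℚ) Z).support = Z.support :=
    support_map_of_injective Z (RingHom.injective_int _)
  haveI : Nonempty Z.support := by
    obtain ⟨γ, hγ⟩ := exists_coeff_ne_zero hZ0
    exact ⟨⟨γ, mem_support_iff.mpr hγ⟩⟩
  let e : (map (Int.castRingHom ℚ) Z).support ≃ Z.support :=
    Equiv.subtypeEquivRight fun x => by rw [hsupp]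
  have hfun : (fun γ : (map (Int.castRingHom ℚ) Z).support => (map (Int.castRingHom ℚ) Z).coeff γ) =
      (((↑) : ℤ → ℚ) ∘ fun i : Z.support => coeff i.1 Z) ∘ e := by
    funext γ
    simp [e, coeff_map]
  rw [height, hfun, logHeight_comp_equiv, Rat.logHeight_eq_max_abs_of_gcd_eq_one]
  exact (gcd_univ_subtype_eq _ _).trans hZ

/-- Every coefficient of a primitive integer polynomial is bounded by its height:
`log |a_γ| ≤ h(Z)`. [cite: NesterenkoPhilippon2001, Ch. 3 §4, remark after Def. 4.2 (p. 38)] -/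
theorem log_abs_coeff_le_height_map (Z : MvPolynomial σ ℤ)
    (hZ : Z.support.gcd (fun γ => coeff γ Z) = 1) {γ : σ →₀ ℕ} (hγ : γ ∈ Z.support) :
    Real.log (|coeff γ Z| : ℤ) ≤ height (map (Int.castRingHom ℚ) Z) := by
  rw [height_map_eq_log_ciSup Z hZ]
  have hpos : (0 : ℝ) < ((|coeff γ Z| : ℤ) : ℝ) := by
    have h : coeff γ Z ≠ 0 := mem_support_iff.mp hγ
    exact_mod_cast abs_pos.mpr h
  refine Real.log_le_log hpos ?_
  have h := le_ciSup (Finite.bddAbove_range fun i : Z.support => |coeff i.1 Z|) ⟨γ, hγ⟩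
  exact_mod_cast h

/-- For a coefficient of maximal modulus the bound is attained: `h(Z) = log |a_γ|`.
[cite: NesterenkoPhilippon2001, Ch. 3 §4, remark after Def. 4.2 (p. 38)] -/
theorem height_map_eq_log_abs_coeff (Z : MvPolynomial σ ℤ)
    (hZ : Z.support.gcd (fun γ => coeff γ Z) = 1) {γ : σ →₀ ℕ} (hγ : γ ∈ Z.support)
    (hmax : ∀ δ ∈ Z.support, |coeff δ Z| ≤ |coeff γ Z|) :
    height (map (Int.castRingHom ℚ) Z) = Real.log (|coeff γ Z| : ℤ) := by
  refine le_antisymm ?_ (log_abs_coeff_le_height_map Z hZ hγ)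
  rw [height_map_eq_log_ciSup Z hZ]
  haveI : Nonempty Z.support := ⟨⟨γ, hγ⟩⟩
  have hpos : (0 : ℝ) < ((⨆ i : Z.support, |coeff i.1 Z| : ℤ) : ℝ) := by
    have h1 : |coeff γ Z| ≤ ⨆ i : Z.support, |coeff i.1 Z| :=
      le_ciSup (Finite.bddAbove_range fun i : Z.support => |coeff i.1 Z|) ⟨γ, hγ⟩
    have h2 : 0 < |coeff γ Z| := abs_pos.mpr (mem_support_iff.mp hγ)
    exact_mod_cast h2.trans_le h1
  refine Real.log_le_log hpos ?_
  exact_mod_cast ciSup_le fun i : Z.support => hmax i.1 i.2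

end Nesterenko

end Literature.NumberTheory.Transcendental

end
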